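import Summits.Ventures.AbcSig.Rows.Bridge
import Summits.Ventures.AbcSig.Rows.C2aL349A7
import Summits.Ventures.AbcSig.Rows.C2aL349A7AB

/-!
# Venture AbcSig — CELL `C2aL349A7`: the census statement `Rows.C2aCellRed 349 (fun a => 7 ≤ a) {11}` from the two row theorems

HONEST FRAMING. COMPUTATION cell `pub-abcsig`; CONDITIONAL theorem; no claim on ABC or any summit. Hypotheses exactly as
in `Rows/C2aL349A7.lean` and `Rows/C2aL349A7AB.lean`: `BS04Package` (CITED), `DataComplete …` (COMPUTED level files), and the
rows' per-orbit exclusions for BOTH family predicates (`famB`, `famAB`) as `∀ n a m, …` hypotheses (CITED: the census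
row's certificates). Conclusion = p1's census predicate (`Rows/Statements.lean`), all four coprime coefficient
distributions `A·B = 2^a·349^m`, reduced exponents `a < n`, `m < n` (RULING H1). GENERATED by plean/make_cell_bridges.py.
-/

namespace Summit.Ventures.AbcSig

/-- Cell `C2aL349A7`: `Rows.C2aCellRed 349 (fun a => 7 ≤ a) {11}` under the rows' hypotheses. -/
theorem cell_C2aL349A7 (M : NewformModel) (hP : M.BS04Package)
    (hD698 : M.DataComplete 698 level698Orbits) :
    Rows.C2aCellRed 349 (fun a => 7 ≤ a) {11} :=
  C2aCellRed_of_rows 349 (by norm_num) (by norm_num) _ _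
    (fun n hn h11 hnℓ hR a m ha han hm hmn x y z h1 h2 =>
      row_C2aL349A7 M hP hD698 n hn h11 hnℓ (by simpa using hR) a m ha hm han hmn x y z h1 h2)
    (fun n hn h11 hnℓ hR a m ha han hm hmn x y z h1 h2 =>
      row_C2aL349A7AB M hP hD698 n hn h11 hnℓ (by simpa using hR) a m ha hm han hmn x y z h1 h2)

end Summit.Ventures.AbcSig
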